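import Mathlib
import Summits.KontsevichZagierPeriods.Zeta5Search.Elimination.HalfShiftBridge
import Summits.KontsevichZagierPeriods.Zeta5Search.Elimination.HalfShiftGauge
import Summits.KontsevichZagierPeriods.Zeta5Search.WedgeDictionaryBridge
import HarnessLib

/-!
# gen-1's `DictBridge` pointwise on the interior (E-L19c, part 2b₂; fam-elim gen 24)

HONEST FRAMING: systematic search; no irrationality claim unless certified — identities among the rational Taylor
data of the Ball–Rivoal family and gen-1's dictionary values `(Q, P̂, P)`; nothing here is about sizes or irrationality.

OUR work (Summit side; `families/elim/FAMILY.md` §17).  gen-1's conjecture node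
`WedgeDictionary.DictBridge` (`WedgeDictionaryBridge.lean`) is the four-term relation

  `bridgeBase(c)·v(a) + bridgeSlot(c)·v(a − s₇) + bridgeHalf(c)·v(a + e₁ + e₃) + bridgeApex(c)·v(a + DS) = 0`,
  `v = (Q, P̂, P)`, `c = b(a)`,

at the cluster `{c, c+e₇, Hc, DSc}` of dual vectors (`b(a − s₇) = c + e₇ = bump c 6`, `b(a + e₁ + e₃) = Hc = hShift c`,
`b(a + DS) = DSc = dsShift c`).  This file PROVES it at every point of the interior region — `RegionHyp` at the four
points, level `c₀ ≥ 2`, and the six non-edge pair sums `c_j + c_k ≤ c₀` (`{j,k} ∈ {16,17,27,35,45,46}`; the fifteen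
edge pair sums are `≤ c₀` automatically on the convergence cone) — by pure assembly of kernel theorems:

1. the ρ-free half-shift BRIDGE (`Elimination/HalfShiftBridge.halfShiftBridge`, E-L19c-2a): for each slot-7 wedge
   coordinate `X ∈ {U∧W, U∧V, V∧W}`, `A·d·X(DSz) + λ·pr·X(Hz) = λ·A·B₀·X(z) + π_T·d·X(z+e₇)` at `z = c`;
2. the dictionary values are `ρ` times the wedges (`Elimination/PencilGauge.dict_values`): `Q = ρ·(U∧W)`,
   `P̂ = ρ·(U∧V)`, `P = ρ·(V∧W)` at each of the four points;
3. the three gauge ratios of `ρ = rhoB` (pure factorial bookkeeping): `ρ(DSz)·∏_{j∈{1,4,5,6,7}}(z_j+1) = −d·ρ(z)`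
   (`rhoB_dsShift`), `ρ(Hz)·(z₀−z₄−z₇)(z₀−z₅−z₇)·π_T = −∏_{jk∈{12,13,23,26,36}}(z₀+1−z_j−z_k)·ρ(z)` (`rhoB_hShift`),
   `ρ(z)·d = −(z₇+1)·∏_{k∈{3,4,5,6}}(z₀−z_k−z₇)·ρ(z+e₇)` (`rhoB_bump6`, both E-L19c-2b₁);
4. five low-degree polynomial identities between gen-1's coefficient functions and the bridge coefficients, closed
   by `ring` / `ac_rfl`: `bridgeApex·π_T = F := ∏_{j∈{1,4,5,6,7}}(z_j+1)`, `bridgeBase·π_T = λ·B₀`,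
   `bridgeSlot = −(z₀−z₃−z₇)(z₀−z₆−z₇)`, `bridgeHalf·(z₇+1) = λ·(z₀+1−z₁−z₆)`, `pr = ∏_{12,13,23,26,36}(…)·(z₀+1−z₁−z₆)`.

The scalar skeleton is `bridge_assemble` (one `linear_combination`, then cancel the non-zero product
`F·(z₇+1)·(z₀−z₄−z₇)(z₀−z₅−z₇)·d·π_T`); the bridge is `dictBridge_at`; `DictBridgeBoundary` (`@[conjecture]`, OPEN,
minted here as the honest residual) is the node restricted to the boundary clusters, and `dictBridge_of_boundary`
(a CONDITIONAL edge, crediting nothing by itself) records that the GLOBAL node `DictBridge` now follows from it.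
Sanity instance (gen-1, g15): `a = (4,3,6,3,4,4,7,6)`, `c = (12;5,3,3,5,3,5,0)`, coefficients `(104, −63, 39, 36)`.

What this is NOT: the boundary strata of the GLOBAL node `DictBridge` (level `c₀ ≤ 1`, or a non-edge pair sum
`= c₀ + 1`, where `cas3`, `pr` or `Q` may vanish and the ρ-free bridge is not available) are not treated here; nothing
about sizes, denominators or irrationality; the class verdict is unchanged (T1 NO / T2 NO / T4 YES).
-/

open Finset

namespace Summit.KontsevichZagierPeriods.Zeta5Search.Elimination

open Summit.KontsevichZagierPeriods.Zeta5Search.DualSeries (InBox)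
open Summit.KontsevichZagierPeriods.Zeta5Search.WedgeDictionary
open Summit.KontsevichZagierPeriods.Zeta5Search.SymmetricGauge
open Literature.NumberTheory.Irrationality.BrownZudilin2022 (bOfA Converges QOf)

/-! ### 1. The scalar skeleton -/

/-- The scalar skeleton of the gauged bridge: the ρ-free bridge `hT` (with `A = s₇·m₄·m₅` factored), the three gauge
ratios `h1`–`h3` and five low-degree identities between gen-1's coefficients `α, β, γ, δ` and the bridge coefficients
give gen-1's relation `α·ρ_z X_z + β·ρ₇ X₇ + γ·ρ_H X_H + δ·ρ_D X_D = 0`, after cancelling `F·s₇·m₄·m₅·d·π_T ≠ 0`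
(one `linear_combination`; certificate checked outside Lean, `HOME/pub-zeta5-fam-elim/g24/check_assemble2.py`). -/
theorem bridge_assemble {α β γ δ ρz ρ7 ρH ρD Xz X7 XH XD d lam pr B0 piT F NH n16 m3 m4 m5 m6 s7 : ℚ}
    (hT : s7 * m4 * m5 * d * XD + lam * pr * XH = lam * (s7 * m4 * m5) * B0 * Xz + piT * d * X7)
    (h1 : ρD * F = -(d * ρz)) (h2 : ρH * (m4 * m5) * piT = -(NH * ρz))
    (h3 : ρz * d = -(s7 * (m3 * m4 * m5 * m6) * ρ7))
    (hδ : δ * piT = F) (hα : α * piT = lam * B0) (hβ : β = -(m3 * m6)) (hγ : γ * s7 = lam * n16)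
    (hpr : pr = NH * n16)
    (hF : F ≠ 0) (hs7 : s7 ≠ 0) (hm4 : m4 ≠ 0) (hm5 : m5 ≠ 0) (hd : d ≠ 0) (hpiT : piT ≠ 0) :
    α * (ρz * Xz) + β * (ρ7 * X7) + γ * (ρH * XH) + δ * (ρD * XD) = 0 := by
  have key : (F * s7 * (m4 * m5) * d * piT) * (α * (ρz * Xz) + β * (ρ7 * X7) + γ * (ρH * XH) + δ * (ρD * XD)) = 0 := by
    linear_combination (piT * δ * s7 * (m4 * m5) * d * XD) * h1 - (piT * δ * d * ρz) * hT +
      (-(α * s7 * m4 * m5 * d * piT * ρz * Xz) + s7 * d * piT * ρ7 * X7 * (m3 * m4 * m5 * m6) +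
          d * ρz * XH * lam * n16 * NH) * hδ +
      (δ * s7 * m4 * m5 * d * piT * ρz * Xz) * hα - (piT * piT * δ * d * X7) * h3 +
      (s7 * d * piT * ρ7 * X7 * (m4 * m5) * F) * hβ + (F * s7 * d * γ * XH) * h2 - (d * ρz * XH * F * NH) * hγ +
      (d * ρz * XH * δ * lam * piT) * hpr
  rcases mul_eq_zero.1 key with h | h
  · exact absurd h (mul_ne_zero (mul_ne_zero (mul_ne_zero (mul_ne_zero hF hs7) (mul_ne_zero hm4 hm5)) hd) hpiT)
  · exact h

/-! ### 2. The bridge -/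

/-- **THE BRIDGE — gen-1's `DictBridge` pointwise on the interior.**  `RegionHyp` at the four points `a`, `a − s₇`,
`a + e₁ + e₃`, `a + DS`, `c = b(a)` with `c₀ ≥ 2` and `c_j + c_k ≤ c₀` for the six non-edge pairs:
`bridgeBase(c)·v(a) + bridgeSlot(c)·v(a − s₇) + bridgeHalf(c)·v(a + e₁ + e₃) + bridgeApex(c)·v(a + DS) = 0` for the
three dictionary coordinates `v = (Q, P̂, P)` (the instance of `WedgeDictionary.DictBridge` at `a`). -/
theorem dictBridge_at (a : Fin 8 → ℤ) (j₀ j₁ j₂ j₃ : ℕ) (H₀ : RegionHyp a j₀) (H₁ : RegionHyp (a - slotDown 7) j₁)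
    (H₂ : RegionHyp (a + halfUp457) j₂) (H₃ : RegionHyp (a + dsUp) j₃) (hN : 2 ≤ bOfA a 0)
    (hNE : ∀ jk ∈ nonEpairs, bOfA a jk.1 + bOfA a jk.2 ≤ bOfA a 0) :
    DictFourTerm (bridgeBase (bOfA a)) (bridgeSlot (bOfA a)) (bridgeHalf (bOfA a)) (bridgeApex (bOfA a))
      a (a - slotDown 7) (a + halfUp457) (a + dsUp) j₀ j₁ j₂ j₃ := by
  -- the dictionary values at the four points (before destructuring the hypotheses)
  obtain ⟨hQ0, hPh0, hP0⟩ := dict_values H₀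
  obtain ⟨hQ1, hPh1, hP1⟩ := dict_values H₁
  obtain ⟨hQ2, hPh2, hP2⟩ := dict_values H₂
  obtain ⟨hQ3, hPh3, hP3⟩ := dict_values H₃
  obtain ⟨-, hconv, hreg, -, -⟩ := H₀
  obtain ⟨-, hconv1, hreg1, -, -⟩ := H₁
  obtain ⟨-, hconv2, -, -, -⟩ := H₂
  obtain ⟨-, -, -, hd3, -⟩ := H₃
  set c := bOfA a with hc
  -- the dual coordinates of the three other points: `c + e₇`, `Hc`, `DSc`
  have h7b : ∀ j, j ≤ 7 → bOfA (a - slotDown 7) j = bump c 6 j := fun j hj => by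
    rw [bOfA_sub_slotDown7 a j hj]
    by_cases h : j = 7
    · rw [if_pos h, h, bump6_seven]
    · rw [if_neg h, bump_of_ne c (show j ≠ 6 + 1 by omega)]
  have hHb : ∀ j, j ≤ 7 → bOfA (a + halfUp457) j = hShift c j := fun j hj => by
    rw [bOfA_add_halfUp457 a j hj]
    unfold hShift
    rfl
  have hDb : ∀ j, j ≤ 7 → bOfA (a + dsUp) j = dsShift c j := fun j hj => by
    rw [bOfA_add_dsUp a j hj, dsShift_apply]
  -- facts at `c`
  have hE : ∀ jk ∈ Epairs, c jk.1 + c jk.2 ≤ c 0 := epairs_le_of_converges a hconv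
  have hcs : ∀ k, 1 ≤ k → k ≤ 7 → 0 ≤ c k ∧ 2 * c k ≤ c 0 + 1 := fun k h1 h7 =>
    hreg k (mem_Icc.2 ⟨h1, h7⟩)
  have hc7 := hcs 7 (by norm_num) (by norm_num)
  have h7 : c 7 + 2 ≤ c 0 := by
    have h := (hreg1 7 (by simp)).2
    rw [h7b 7 (by norm_num), h7b 0 (by norm_num), bump6_seven, bump_zero] at h
    omega
  have hcI : InBox c := ⟨by omega, fun j hj => by
    have := hcs (j + 1) (by omega) (by have := mem_range.1 hj; omega); omega⟩
  have hd : 1 ≤ dOf c := by rw [dOf_congr hDb, dOf_dsShift] at hd3; omega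
  have hp : ∀ jk ∈ allPairs, c jk.1 + c jk.2 ≤ c 0 := fun jk hjk => by
    obtain ⟨h1, h12, h2⟩ := allPairs_bounds jk hjk
    rcases pair_mem_epairs_or_nonEpairs jk.1 jk.2 h1 h12 h2 with hm | hm
    · exact hE _ hm
    · exact hNE _ hm
  -- the two strict `T`-pair inequalities (edge pairs `47`, `57` at `Hc`) and the edge pairs at `c + e₇`
  obtain ⟨v0, -, -, -, v4, v5, -, v7⟩ := hShift_vals c
  have h47 : c 4 + c 7 + 1 ≤ c 0 := by
    have h := epairs_le_of_converges _ hconv2 (4, 7) (by decide)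
    simp only at h
    rw [hHb 4 (by norm_num), hHb 7 (by norm_num), hHb 0 (by norm_num), v0, v4, v7] at h
    omega
  have h57 : c 5 + c 7 + 1 ≤ c 0 := by
    have h := epairs_le_of_converges _ hconv2 (5, 7) (by decide)
    simp only at h
    rw [hHb 5 (by norm_num), hHb 7 (by norm_num), hHb 0 (by norm_num), v0, v5, v7] at h
    omega
  have hE7 : ∀ jk ∈ Epairs, bump c 6 jk.1 + bump c 6 jk.2 ≤ c 0 := fun jk hjk => by
    obtain ⟨-, h17, -, h27, -⟩ := epairs_bounds jk hjk
    have h := epairs_le_of_converges _ hconv1 jk hjk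
    rw [h7b jk.1 h17, h7b jk.2 h27, h7b 0 (by norm_num), bump_zero] at h
    exact h
  -- (1) the ρ-free bridge, with `d` as `dOf` and `A` factored
  obtain ⟨TUW, TUV, TVW⟩ := halfShiftBridge c hcI hd h7 hp
  rw [raiseD_eq, meetA_factor] at TUW TUV TVW
  -- (2) the three gauge ratios
  have R1 := rhoB_dsShift c hcI hd
  have R2 := rhoB_hShift c hcI h47 h57 (hE (1, 2) (by decide)) (hE (1, 3) (by decide)) (hE (2, 3) (by decide))
    (hE (2, 6) (by decide)) (hE (3, 6) (by decide))
  have R3 := rhoB_bump6 c hcI (by omega) hd hE7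
  -- (3) the five coefficient identities (`F = ∏_{j∈{1,4,5,6,7}}(c_j+1)`)
  have hpi : ((c 4 : ℚ) + 1) * ((c 5 : ℚ) + 1) * ((c 7 : ℚ) + 1) = raisePiT c := rfl
  rw [hpi] at R2
  have hδ : (bridgeApex c : ℚ) * raisePiT c = ((([1, 4, 5, 6, 7] : List ℕ).map fun j => ((c j : ℚ) + 1)).prod) := by
    simp only [List.map_cons, List.map_nil, List.prod_cons, List.prod_nil, bridgeApex, raisePiT]
    push_cast
    ring
  have hα : (bridgeBase c : ℚ) * raisePiT c = dsLam c 6 * bridgeB0 c := by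
    simp only [bridgeBase, raisePiT, bridgeB0, dsLam_six]
    push_cast
    ring
  have hβ : (bridgeSlot c : ℚ) = -(((c 0 : ℚ) - c 3 - c 7) * ((c 0 : ℚ) - c 6 - c 7)) := by
    simp only [bridgeSlot]
    push_cast
    ring
  have hγ : (bridgeHalf c : ℚ) * ((c 7 : ℚ) + 1) = dsLam c 6 * ((c 0 : ℚ) + 1 - c 1 - c 6) := by
    simp only [bridgeHalf, dsLam_six]
    push_cast
    ring
  have hpr : raisePr c = ((c 0 : ℚ) + 1 - c 1 - c 2) * ((c 0 : ℚ) + 1 - c 1 - c 3) * ((c 0 : ℚ) + 1 - c 2 - c 3) *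
      ((c 0 : ℚ) + 1 - c 2 - c 6) * ((c 0 : ℚ) + 1 - c 3 - c 6) * ((c 0 : ℚ) + 1 - c 1 - c 6) := by
    unfold raisePr
    ac_rfl
  -- non-vanishing of the cancelled product
  have p1 := (hcs 1 (by norm_num) (by norm_num)).1
  have p4 := (hcs 4 (by norm_num) (by norm_num)).1
  have p5 := (hcs 5 (by norm_num) (by norm_num)).1
  have p6 := (hcs 6 (by norm_num) (by norm_num)).1
  have q1 : (0 : ℚ) < c 1 + 1 := by have := (show (0 : ℚ) ≤ c 1 by exact_mod_cast p1); linarith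
  have q4 : (0 : ℚ) < c 4 + 1 := by have := (show (0 : ℚ) ≤ c 4 by exact_mod_cast p4); linarith
  have q5 : (0 : ℚ) < c 5 + 1 := by have := (show (0 : ℚ) ≤ c 5 by exact_mod_cast p5); linarith
  have q6 : (0 : ℚ) < c 6 + 1 := by have := (show (0 : ℚ) ≤ c 6 by exact_mod_cast p6); linarith
  have q7 : (0 : ℚ) < c 7 + 1 := by have := (show (0 : ℚ) ≤ c 7 by exact_mod_cast hc7.1); linarith
  have hF : ((([1, 4, 5, 6, 7] : List ℕ).map fun j => ((c j : ℚ) + 1)).prod) ≠ 0 := by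
    simp only [List.map_cons, List.map_nil, List.prod_cons, List.prod_nil, mul_one]
    positivity
  have hs7 : (c 7 : ℚ) + 1 ≠ 0 := q7.ne'
  have hm4 : (c 0 : ℚ) - c 4 - c 7 ≠ 0 := by
    have : (1 : ℚ) ≤ (c 0 : ℚ) - c 4 - c 7 := by exact_mod_cast (show 1 ≤ c 0 - c 4 - c 7 by omega)
    exact ne_of_gt (by linarith)
  have hm5 : (c 0 : ℚ) - c 5 - c 7 ≠ 0 := by
    have : (1 : ℚ) ≤ (c 0 : ℚ) - c 5 - c 7 := by exact_mod_cast (show 1 ≤ c 0 - c 5 - c 7 by omega)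
    exact ne_of_gt (by linarith)
  have hdq : (dOf c : ℚ) ≠ 0 := by
    have : (1 : ℚ) ≤ dOf c := by exact_mod_cast hd
    exact ne_of_gt (by linarith)
  have hpiT : raisePiT c ≠ 0 := by unfold raisePiT; positivity
  -- rewrite the twelve dictionary values
  rw [rhoOf_eq_rhoB, ← hc] at hQ0 hPh0 hP0
  rw [rhoOf_eq_rhoB] at hQ1 hPh1 hP1 hQ2 hPh2 hP2 hQ3 hPh3 hP3
  rw [rhoB_congr h7b, (cas_congr h7b).1] at hQ1
  rw [rhoB_congr h7b, (cas_congr h7b).2.1] at hPh1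
  rw [rhoB_congr h7b, (cas_congr h7b).2.2] at hP1
  rw [rhoB_congr hHb, (cas_congr hHb).1] at hQ2
  rw [rhoB_congr hHb, (cas_congr hHb).2.1] at hPh2
  rw [rhoB_congr hHb, (cas_congr hHb).2.2] at hP2
  rw [rhoB_congr hDb, (cas_congr hDb).1] at hQ3
  rw [rhoB_congr hDb, (cas_congr hDb).2.1] at hPh3
  rw [rhoB_congr hDb, (cas_congr hDb).2.2] at hP3
  unfold DictFourTerm
  rw [hQ0, hPh0, hP0, hQ1, hPh1, hP1, hQ2, hPh2, hP2, hQ3, hPh3, hP3]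
  exact ⟨bridge_assemble TUW R1 R2 R3 hδ hα hβ hγ hpr hF hs7 hm4 hm5 hdq hpiT,
    bridge_assemble TUV R1 R2 R3 hδ hα hβ hγ hpr hF hs7 hm4 hm5 hdq hpiT,
    bridge_assemble TVW R1 R2 R3 hδ hα hβ hγ hpr hF hs7 hm4 hm5 hdq hpiT⟩

/-! ### 3. The global node reduces to its boundary strata -/

/-- **The boundary strata of gen-1's `DictBridge` (OPEN; INTERNALLY MINTED residual, stated here).**  gen-1's node
restricted to the bridge clusters that `dictBridge_at` does not reach: level `b₀(a) ≤ 1`, or a non-edge pair sum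
exceeding the level (`b_j + b_k = b₀ + 1` for some `{j,k} ∈ {16,17,27,35,45,46}`; there `Q(a) = 0`, and the ρ-free
bridge of `Elimination/HalfShiftBridge` is unavailable because its non-degeneracy hypotheses — all pair sums `≤ b₀`,
`Q·pr·cas3 ≠ 0` — fail).  `DictBridge` follows from it (`dictBridge_of_boundary`) and conversely it is a restriction of
`DictBridge` (immediate), so the two nodes are equivalent; BOTH ARE OPEN.  NOT a claim: no proof and no counterexample
is known to us on these strata; expected tools are the face closed forms of the wedges (where `Q = 0`) and a finite
check at level `1`. -/
@[conjecture] def DictBridgeBoundary : Prop :=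
  ∀ (a : Fin 8 → ℤ) (j₀ j₁ j₂ j₃ : ℕ), (bOfA a 0 ≤ 1 ∨ ∃ jk ∈ nonEpairs, bOfA a 0 < bOfA a jk.1 + bOfA a jk.2) →
    RegionHyp a j₀ → RegionHyp (a - slotDown 7) j₁ → RegionHyp (a + halfUp457) j₂ → RegionHyp (a + dsUp) j₃ →
      DictFourTerm (bridgeBase (bOfA a)) (bridgeSlot (bOfA a)) (bridgeHalf (bOfA a)) (bridgeApex (bOfA a))
        a (a - slotDown 7) (a + halfUp457) (a + dsUp) j₀ j₁ j₂ j₃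

/-- **`DictBridge` ⟸ its boundary strata**: everything off the boundary is `dictBridge_at`. -/
theorem dictBridge_of_boundary (hB : DictBridgeBoundary) : DictBridge := by
  unfold DictBridge
  intro a j₀ j₁ j₂ j₃ H₀ H₁ H₂ H₃
  by_cases hb : bOfA a 0 ≤ 1 ∨ ∃ jk ∈ nonEpairs, bOfA a 0 < bOfA a jk.1 + bOfA a jk.2
  · exact hB a j₀ j₁ j₂ j₃ hb H₀ H₁ H₂ H₃
  · simp only [not_or, not_exists, not_and, not_lt] at hb
    obtain ⟨hb1, hb2⟩ := hb
    exact dictBridge_at a j₀ j₁ j₂ j₃ H₀ H₁ H₂ H₃ (by omega) fun jk hjk => hb2 jk hjk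

end Summit.KontsevichZagierPeriods.Zeta5Search.Elimination
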